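import Summits.QuantumFields.BalabanUV.Beta.GAN24.LayerPushFrozen
import Summits.QuantumFields.BalabanUV.Beta.GAN24.LayerPushMoments
import Summits.QuantumFields.BalabanUV.Beta.GAN24.Push3GaugeSlotCells
import Summits.QuantumFields.BalabanUV.Beta.DiagonalContact

/-!
# `BalabanUV.Beta.GAN24.LayerPushGaugeTable` — binder row G-an2-4 / (CONV-C), W-slot CT-W, route «WC-TL» ∕ «QR-LL», row **(LT-Δ) «LAYER TRANSPORT»**, part (LT-3b) = (b3) of
# the OWNER gan24-p1 g26's RULING R-gan24p1-g26-2 (journal l.40589, HANDS (i): «the generic GAUGE-TABLE-SLOT identity for `push₃` with an ABSTRACT slot-Ward binder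
# (`∀ λ, Σ'_{u′} Σ_{κ′} dzλ κ′ u′ • S κ′ u′ = comm (S⁰) (diagK λ)`, the shape of `tsum_dz_mul_wilsonA`) + the gauge-cell count letter by letter — GO, THIS SHAPE»)

NOT IN PRINT; OUR BOOKKEEPING ([folklore] the CT-3 template `Push3GaugeSlotCells.push₃_gaugeTable_ff` ∕ leaf-02's `ContactOneGaugeCellAlgebra.tsum_dz_mul_wilsonA_idx` with the
cubic Wilson table replaced by an ABSTRACT letter family and its slot-Ward binder; then leaf-12's `LatticeFreeze` bricks, this lineage's `LayerPushMoments` second-order Taylor and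
`LayerPushEntry`'s weighted block count; G-an2-4 formalisation swarm, leaf prover `b2b-balaban-gan24-formalise-leaf-01`, gen 64).  HONEST FRAMING (cell contract, verbatim):
«discharging `BetaPertH` makes Bałaban's UV stability UNCONDITIONAL — a real constructive-QFT result; it is NOT the continuum limit and NOT the Clay problem.»  HONEST DEPENDENCY
(verbatim): «continuum YM on T⁴ ⇐ BetaPertH ∧ nine spine estimates (0/9 proved); BetaPertH ⇐ (D1) ∧ (D4) ∧ CAP+tail; G-an2-4 gates asym, D1 and NE2/3/4.»

## What (generic `d`, relative blocking `N ≥ 1`, GENERIC legs ∕ letters — no object of an2's typed system occurs)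
§0 spelling bricks: `dz_eq_sub_single`, `abs_cast_apply_le_l1`.
§1 THE SLOT-WARD BINDER AND THE GAUGE-TABLE IDENTITY.  The binder (ff block, the shape of `tsum_dz_mul_wilsonA_idx` ∕ `comm (S⁰) (diagK λ)`):
   `hWard : ∀ ψ x z κ₁ κ₂, Σ_κ Σ'_u dz ψ κ u · S κ u x z κ₁ κ₂ = S₀ x z κ₁ κ₂ · (ψ z − ψ x)` — the slot contraction of the letter family `S` against ANY pure gauge is the
   commutator of its ZEROTH-ORDER COMPANION `S₀` with the multiplication by the gauge function.  Then **`vertexW_gaugeTable_ff`** ∕ **`vertexW_gaugeTable_ff_eq_conjV`**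
   (`vertexW (dz λ) S ν U x z κ₁ κ₂ = S₀ x z κ₁ κ₂·(λ_{νU} z − λ_{νU} x) = conjV S₀ (diagK λ_{νU}) x z κ₁ κ₂` — the tree's commutator `ChartConjugation.conjV` with a diagonal
   kernel `BorderedHessian.diagK`), **`push₃_gaugeTable_inl_inl`** (THE GAUGE-TABLE CELL: the table leg is CONSUMED, the push is the two-leg sandwich of the commutator letter:
   `push₃ l r (dz λ) S ν U x′ z′ (inl α)(inl β) = Σ'_z Σ_{κ₂} (Σ'_x Σ_{κ₁} l α x′ κ₁ x · S₀ x z κ₁ κ₂ · (λ_{νU} z − λ_{νU} x)) · r β z′ κ₂ z`), and the DOCKING instance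
   **`slotWard_wilsonA`**: the cubic Wilson table satisfies the binder with companion `½·(d*dδ_{(κ₂,z)})_{κ₁}(x)` (½ the Maxwell stencil) — CT-3's table slot is the instance.
§2 ONE COLUMN `z` of the commutator cell (everything seen from the base point `z`; `S₀`'s column localised `B·e^{−m‖x−z‖₁}`, left leg sup `pl`∕Lipschitz `ql`, gauge
   function with unit steps `g` and Lipschitz unit gradients `g′`, rates `e^{κ‖·−z‖₁}`, `2κ < m`): `abs_lam_sub_le`, `abs_colTerm_le`, **`abs_col_le`**
   (`|Σ'_x Σ_{κ₁} lx·S₀·(λ z − λ x)| ≤ (d+1)·pl·B·g·(2∕(m−2κ))·Zl((m−2κ)∕2)` — NO moment hypothesis), `abs_moment_term_le`, `summable_moment`, `abs_moment_le`, and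
   **`abs_col_sub_dipole_le`**: `|Σ'_x Σ_{κ₁} lx·S₀·(λ z − λ x) + Σ_{κ₁} Σ_i lx κ₁ z·(λ(z+e_i) − λ z)·Π_i(z; κ₁κ₂)| ≤ (d+1)²·B·(ql·g + pl·g′)·(8∕(m−2κ)²)·Zl((m−2κ)∕4)`,
   `Π_i(z; κ₁κ₂) := Σ'_x (x−z)_i·S₀ x z κ₁ κ₂` THE COMPANION's COLUMN DIPOLE MOMENTS — the commutator kills the constant part of `λ` by itself (NO charge hypothesis), the
   linear part reads the dipole moments against the gauge table leg AT THE KERNEL SITE, the rest carries ONE gradient constant (`g′` = unit differences of the gauge table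
   leg, or `ql` = unit gradient of the kernel leg).
§3–§4 (THE CELL through coarse envelopes — base count, count minus the DIPOLE term, dipole-free corollary — and the LEDGER lines `L^{d−3}` ∕ `L^{d−4}`) are file 2
   `GAN24/LayerPushGaugeTableCell` (split off for the gate's size cap; statements as announced in INTENT I-leaf01-g64-1).
[folklore]; 0 cited facts, 0 `def`, 0 `def … : Prop`, 0 sorry.  Asserts NOTHING about which σ-letters satisfy the binder or have dipole-free companions (HANDS (ii): p2 ∕ the
OWNER ∕ an1–asym1 by name); NOTHING of (Q-R)∕(LT)∕(Q-L)∕(C)∕«T2Shape»∕«T2Drift»∕(hW, hWall) discharged; NEVER «G-an2-4 closed» as (CONV-C); NOT D1, NOT `BetaPertH`, NOT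
continuum, NOT Clay.  2026-08-22.
-/

noncomputable section

open Finset
open scoped BigOperators
open Literature.MathematicalPhysics.QuantumFieldTheory
open Literature.MathematicalPhysics.QuantumFieldTheory.Balaban1983to89
open Literature.MathematicalPhysics.QuantumFieldTheory.Balaban1983to89.Beta
open B12Sec2to5 (l1 l1_nonneg)
open ExpKernelCalculus (MKer Zl Zl_nonneg Zl_pos summable_exp_shift' tsum_exp_shift' l1_sub_triangle l1_sub_symm)
open OneStepResolventKernel (Fib)
open LatticeForm (quo)
open AffineAveraging (dz curv curvAdj)
open KKTFluctuationKernel (delta1)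
open StepJetData (wilsonA)
open Summit.QuantumFields.BalabanUV.Beta.ChartConjugation (conjV)
open Summit.QuantumFields.BalabanUV.Beta.BorderedHessian (diagK conjV_diagK_apply)
open Summit.QuantumFields.BalabanUV.Beta.GAN24.Push4 (vertexW vertexW_apply)
open Summit.QuantumFields.BalabanUV.Beta.GAN24.Push3 (push₃ push₃_inl_inl)
open Summit.QuantumFields.BalabanUV.Beta.GAN24.Push4TwoRate (summable_leg)
open Summit.QuantumFields.BalabanUV.Beta.GAN24.LatticeFreeze (abs_sub_le_of_unit_steps mul_exp_neg_le)
open Summit.QuantumFields.BalabanUV.Beta.GAN24.LayerPushMoments (abs_sub_sub_lin_le_of_unit_steps sq_mul_exp_neg_le)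
open Summit.QuantumFields.BalabanUV.Beta.GAN24.LayerPushEntry (abs_tsum_le_tsum_of_abs_le exp_three_le)
open Summit.QuantumFields.BalabanUV.Beta.GAN24.LayerPushFrozenSlice (exp_wobble leg_rel_sup leg_rel_lip)
open Summit.QuantumFields.BalabanUV.Beta.GAN24.ContactOneGaugeCellAlgebra (tsum_dz_mul_wilsonA_idx summable_mul_wilsonA_idx)

namespace Summit.QuantumFields.BalabanUV.Beta.GAN24.LayerPushGaugeTable

variable {d : ℕ}

/-! ## §0 Spelling bricks -/

/-- [folklore] `dz ψ i p = ψ (p + e_i) − ψ p` in the `Pi.single` spelling of `LatticeFreeze` ∕ `LayerPushMoments` (`AffineAveraging.unitVec i = Pi.single i 1` by `rfl`). -/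
theorem dz_eq_sub_single (ψ : (Fin (d + 1) → ℤ) → ℝ) (i : Fin (d + 1)) (p : Fin (d + 1) → ℤ) :
    dz ψ i p = ψ (p + Pi.single i 1) - ψ p := rfl

/-- [folklore] A coordinate is dominated by the `ℓ¹` norm: `|(v i : ℝ)| ≤ ‖v‖₁`. -/
theorem abs_cast_apply_le_l1 (v : Fin (d + 1) → ℤ) (i : Fin (d + 1)) : |((v i : ℤ) : ℝ)| ≤ l1 v := by
  unfold l1
  exact Finset.single_le_sum (f := fun μ => |((v μ : ℤ) : ℝ)|) (fun μ _ => abs_nonneg _) (Finset.mem_univ i)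

/-! ## §1 The slot-Ward binder and the gauge-table identity -/

section Identity

variable {l r : Fin (d + 1) → (Fin (d + 1) → ℤ) → Fin (d + 1) → (Fin (d + 1) → ℤ) → ℝ}
  {lam : Fin (d + 1) → (Fin (d + 1) → ℤ) → (Fin (d + 1) → ℤ) → ℝ}
  {S : Fin (d + 1) → (Fin (d + 1) → ℤ) → MKer (d + 1) (Fib d)} {S₀ : MKer (d + 1) (Fib d)}
  (hWard : ∀ (ψ : (Fin (d + 1) → ℤ) → ℝ) (x z : Fin (d + 1) → ℤ) (κ₁ κ₂ : Fin (d + 1)),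
    ∑ κ : Fin (d + 1), ∑' u : Fin (d + 1) → ℤ, dz ψ κ u * S κ u x z (Sum.inl κ₁) (Sum.inl κ₂)
      = S₀ x z (Sum.inl κ₁) (Sum.inl κ₂) * (ψ z - ψ x))

include hWard in
/-- NOT IN PRINT; OUR BOOKKEEPING.  **THE TABLE VERTEX THROUGH A PURE-GAUGE TABLE LEG IS THE COMMUTATOR LETTER** (the slot-Ward binder read through `vertexW_apply`):
`vertexW (dz λ) S ν U x z κ₁ κ₂ = S₀ x z κ₁ κ₂ · (λ_{νU} z − λ_{νU} x)`. -/
theorem vertexW_gaugeTable_ff (ν : Fin (d + 1)) (U x z : Fin (d + 1) → ℤ) (κ₁ κ₂ : Fin (d + 1)) :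
    vertexW (fun ν U κ u => dz (lam ν U) κ u) S ν U x z (Sum.inl κ₁) (Sum.inl κ₂)
      = S₀ x z (Sum.inl κ₁) (Sum.inl κ₂) * (lam ν U z - lam ν U x) := by
  rw [vertexW_apply]
  exact hWard (lam ν U) x z κ₁ κ₂

include hWard in
/-- NOT IN PRINT; OUR BOOKKEEPING.  The same in the tree's commutator vocabulary (`ChartConjugation.conjV`, `BorderedHessian.diagK`, `conjV_diagK_apply`):
`vertexW (dz λ) S ν U x z κ₁ κ₂ = conjV S₀ (diagK λ_{νU}) x z κ₁ κ₂` — «`comm (S⁰) (diagK λ)`» of the OWNER's hand (i). -/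
theorem vertexW_gaugeTable_ff_eq_conjV (ν : Fin (d + 1)) (U x z : Fin (d + 1) → ℤ) (κ₁ κ₂ : Fin (d + 1)) :
    vertexW (fun ν U κ u => dz (lam ν U) κ u) S ν U x z (Sum.inl κ₁) (Sum.inl κ₂)
      = conjV S₀ (diagK fun y (_ : Fib d) => lam ν U y) x z (Sum.inl κ₁) (Sum.inl κ₂) := by
  rw [vertexW_gaugeTable_ff hWard, conjV_diagK_apply]

include hWard in
/-- NOT IN PRINT; OUR BOOKKEEPING (`Push3.push₃_inl_inl` ⨾ §1).  **THE GAUGE-TABLE CELL**: with a pure-gauge TABLE leg family `(ν, U) ↦ dz λ_{νU}` and a letter family obeying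
the slot-Ward binder, the table leg is CONSUMED and the push is the two-leg sandwich of the commutator letter:
`push₃ l r (dz λ) S ν U x′ z′ (inl α) (inl β) = Σ'_z Σ_{κ₂} (Σ'_x Σ_{κ₁} l α x′ κ₁ x · (S₀ x z κ₁ κ₂ · (λ_{νU} z − λ_{νU} x))) · r β z′ κ₂ z`. -/
theorem push₃_gaugeTable_inl_inl (ν : Fin (d + 1)) (U x' z' : Fin (d + 1) → ℤ) (α β : Fin (d + 1)) :
    push₃ l r (fun ν U κ u => dz (lam ν U) κ u) S ν U x' z' (Sum.inl α) (Sum.inl β)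
      = ∑' z : Fin (d + 1) → ℤ, ∑ κ₂ : Fin (d + 1),
          (∑' x : Fin (d + 1) → ℤ, ∑ κ₁ : Fin (d + 1),
            l α x' κ₁ x * (S₀ x z (Sum.inl κ₁) (Sum.inl κ₂) * (lam ν U z - lam ν U x))) * r β z' κ₂ z := by
  rw [push₃_inl_inl]
  refine tsum_congr fun z => Finset.sum_congr rfl fun κ₂ _ => ?_
  congr 1
  refine tsum_congr fun x => Finset.sum_congr rfl fun κ₁ _ => ?_
  rw [vertexW_gaugeTable_ff hWard]

end Identity

/-- NOT IN PRINT; OUR BOOKKEEPING (leaf-02's `ContactOneGaugeCellAlgebra.tsum_dz_mul_wilsonA_idx` under the finite direction sum).  **DOCKING INSTANCE OF THE BINDER**: the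
cubic Wilson table `wilsonA d` satisfies the slot-Ward binder of §1 with the companion `S₀ x z κ₁ κ₂ = ½·(d*dδ_{(κ₂,z)})_{κ₁}(x)` (½ the Maxwell stencil) — CT-3's table slot
(`Push3GaugeSlotCells.vertexW_dz_wilsonA_ff`) is the instance `S = wilsonA d` of this file. -/
theorem slotWard_wilsonA (ψ : (Fin (d + 1) → ℤ) → ℝ) (x z : Fin (d + 1) → ℤ) (κ₁ κ₂ : Fin (d + 1)) :
    ∑ κ : Fin (d + 1), ∑' u : Fin (d + 1) → ℤ, dz ψ κ u * wilsonA d κ u x z (Sum.inl κ₁) (Sum.inl κ₂)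
      = ((1 / 2 : ℝ) * curvAdj (curv (delta1 κ₂ z)) κ₁ x) * (ψ z - ψ x) := by
  rw [← Summable.tsum_finsetSum (fun κ _ => summable_mul_wilsonA_idx κ x z κ₁ κ₂ (dz ψ κ)), tsum_dz_mul_wilsonA_idx x z κ₁ κ₂ ψ]
  ring

/-! ## §2 One column of the commutator cell, seen from the column site -/

section Column

variable {lx : Fin (d + 1) → (Fin (d + 1) → ℤ) → ℝ} {K : MKer (d + 1) (Fib d)} {lam : (Fin (d + 1) → ℤ) → ℝ} {z : Fin (d + 1) → ℤ}
  {B m κ pl ql g g' : ℝ}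
  (hm : 2 * κ < m) (hκ : 0 ≤ κ) (hB : 0 ≤ B) (hpl : 0 ≤ pl) (hql : 0 ≤ ql) (hg : 0 ≤ g) (hg' : 0 ≤ g')
  (hK : ∀ x κ₁ κ₂, |K x z (Sum.inl κ₁) (Sum.inl κ₂)| ≤ B * Real.exp (-m * l1 (x - z)))
  (hl : ∀ κ₁ x, |lx κ₁ x| ≤ pl * Real.exp (κ * l1 (x - z)))
  (hl' : ∀ κ₁ x, |lx κ₁ x - lx κ₁ z| ≤ ql * l1 (x - z) * Real.exp (κ * l1 (x - z)))
  (hlam1 : ∀ p i, |lam (p + Pi.single i 1) - lam p| ≤ g * Real.exp (κ * l1 (p - z)))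
  (hlam2 : ∀ p i, |(lam (p + Pi.single i 1) - lam p) - (lam (z + Pi.single i 1) - lam z)| ≤ g' * l1 (p - z) * Real.exp (κ * l1 (p - z)))

include hκ hg hlam1 in
/-- [folklore] The multiplier difference across the kernel pair from the gauge function's unit steps (`LatticeFreeze.abs_sub_le_of_unit_steps`):
`|λ z − λ x| ≤ g·‖x−z‖₁·e^{κ‖x−z‖₁}`. -/
theorem abs_lam_sub_le (x : Fin (d + 1) → ℤ) : |lam z - lam x| ≤ g * l1 (x - z) * Real.exp (κ * l1 (x - z)) := by
  rw [abs_sub_comm]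
  exact abs_sub_le_of_unit_steps (f := lam) (u := z) hg hκ hlam1 x

include hm hκ hB hpl hg hK hl hlam1 in
/-- [folklore] One site of the column: `|Σ_{κ₁} lx κ₁ x·S₀ x z κ₁κ₂·(λ z − λ x)| ≤ (d+1)·pl·B·g·(2∕(m−2κ))·e^{−((m−2κ)∕2)‖x−z‖₁}` (two rates `e^{κ‖x−z‖}` against the
column's `e^{−m‖x−z‖}`, the factor `‖x−z‖₁` traded by `LatticeFreeze.mul_exp_neg_le`). -/
theorem abs_colTerm_le (x : Fin (d + 1) → ℤ) (κ₂ : Fin (d + 1)) :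
    |∑ κ₁ : Fin (d + 1), lx κ₁ x * (K x z (Sum.inl κ₁) (Sum.inl κ₂) * (lam z - lam x))|
      ≤ (((d : ℝ) + 1) * pl * B * g * (2 / (m - 2 * κ))) * Real.exp (-((m - 2 * κ) / 2) * l1 (x - z)) := by
  have hc : 0 < m - 2 * κ := sub_pos.2 hm
  have ht0 : 0 ≤ l1 (x - z) := l1_nonneg _
  have e : Real.exp (κ * l1 (x - z)) * Real.exp (-m * l1 (x - z)) * Real.exp (κ * l1 (x - z)) = Real.exp (-(m - 2 * κ) * l1 (x - z)) := by
    rw [← Real.exp_add, ← Real.exp_add]; congr 1; ring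
  have hterm : ∀ κ₁, |lx κ₁ x * (K x z (Sum.inl κ₁) (Sum.inl κ₂) * (lam z - lam x))|
      ≤ pl * B * g * (l1 (x - z) * Real.exp (-(m - 2 * κ) * l1 (x - z))) := by
    intro κ₁
    rw [abs_mul, abs_mul]
    calc |lx κ₁ x| * (|K x z (Sum.inl κ₁) (Sum.inl κ₂)| * |lam z - lam x|)
        ≤ (pl * Real.exp (κ * l1 (x - z))) * ((B * Real.exp (-m * l1 (x - z))) * (g * l1 (x - z) * Real.exp (κ * l1 (x - z)))) :=
          mul_le_mul (hl κ₁ x) (mul_le_mul (hK x κ₁ κ₂) (abs_lam_sub_le hκ hg hlam1 x) (abs_nonneg _) (by positivity)) (by positivity) (by positivity)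
      _ = pl * B * g * (l1 (x - z) * (Real.exp (κ * l1 (x - z)) * Real.exp (-m * l1 (x - z)) * Real.exp (κ * l1 (x - z)))) := by ring
      _ = pl * B * g * (l1 (x - z) * Real.exp (-(m - 2 * κ) * l1 (x - z))) := by rw [e]
  have hme := mul_exp_neg_le hc (l1 (x - z))
  calc |∑ κ₁ : Fin (d + 1), lx κ₁ x * (K x z (Sum.inl κ₁) (Sum.inl κ₂) * (lam z - lam x))|
      ≤ ∑ κ₁ : Fin (d + 1), |lx κ₁ x * (K x z (Sum.inl κ₁) (Sum.inl κ₂) * (lam z - lam x))| := Finset.abs_sum_le_sum_abs _ _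
    _ ≤ ∑ _κ₁ : Fin (d + 1), pl * B * g * (l1 (x - z) * Real.exp (-(m - 2 * κ) * l1 (x - z))) := Finset.sum_le_sum fun κ₁ _ => hterm κ₁
    _ ≤ ∑ _κ₁ : Fin (d + 1), pl * B * g * (2 / (m - 2 * κ) * Real.exp (-((m - 2 * κ) / 2) * l1 (x - z))) :=
        Finset.sum_le_sum fun _ _ => mul_le_mul_of_nonneg_left hme (by positivity)
    _ = _ := by rw [Finset.sum_const, Finset.card_univ, Fintype.card_fin, nsmul_eq_mul]; push_cast; ring

include hm hκ hB hpl hg hK hl hlam1 in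
/-- [folklore] The column's summand is absolutely summable. -/
theorem summable_colTerm (κ₂ : Fin (d + 1)) :
    Summable fun x : Fin (d + 1) → ℤ => ∑ κ₁ : Fin (d + 1), lx κ₁ x * (K x z (Sum.inl κ₁) (Sum.inl κ₂) * (lam z - lam x)) :=
  Summable.of_norm_bounded ((summable_exp_shift' (half_pos (sub_pos.2 hm)) z).mul_left (((d : ℝ) + 1) * pl * B * g * (2 / (m - 2 * κ))))
    fun x => by rw [Real.norm_eq_abs]; exact abs_colTerm_le hm hκ hB hpl hg hK hl hlam1 x κ₂

include hm hκ hB hpl hg hK hl hlam1 in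
/-- NOT IN PRINT; OUR BOOKKEEPING.  **ONE COLUMN OF THE COMMUTATOR CELL, NO MOMENT HYPOTHESIS**:
`|Σ'_x Σ_{κ₁} lx κ₁ x·S₀ x z κ₁κ₂·(λ z − λ x)| ≤ (d+1)·pl·B·g·(2∕(m−2κ))·Zl((m−2κ)∕2)` — the gauge function enters ONLY through its unit steps `g` (the SUP of the gauge table
leg seen from `z`); the size of `λ` itself never enters (the commutator kills constants). -/
theorem abs_col_le (κ₂ : Fin (d + 1)) :
    |∑' x : Fin (d + 1) → ℤ, ∑ κ₁ : Fin (d + 1), lx κ₁ x * (K x z (Sum.inl κ₁) (Sum.inl κ₂) * (lam z - lam x))|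
      ≤ ((d : ℝ) + 1) * pl * B * g * (2 / (m - 2 * κ)) * Zl (d + 1) ((m - 2 * κ) / 2) := by
  have hc : 0 < m - 2 * κ := sub_pos.2 hm
  have h := abs_tsum_le_tsum_of_abs_le (fun x => abs_colTerm_le hm hκ hB hpl hg hK hl hlam1 x κ₂)
    ((summable_exp_shift' (half_pos hc) z).mul_left (((d : ℝ) + 1) * pl * B * g * (2 / (m - 2 * κ))))
  rw [tsum_mul_left, tsum_exp_shift'] at h
  exact h

include hB hK in
/-- [folklore] One site of a column DIPOLE MOMENT: `|(x−z)_i·S₀ x z κ₁κ₂| ≤ B·(2∕m)·e^{−(m∕2)‖x−z‖₁}`. -/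
theorem abs_moment_term_le (hm0 : 0 < m) (x : Fin (d + 1) → ℤ) (i κ₁ κ₂ : Fin (d + 1)) :
    |(((x - z) i : ℤ) : ℝ) * K x z (Sum.inl κ₁) (Sum.inl κ₂)| ≤ B * (2 / m) * Real.exp (-(m / 2) * l1 (x - z)) := by
  rw [abs_mul]
  have hme := mul_exp_neg_le hm0 (l1 (x - z))
  calc |(((x - z) i : ℤ) : ℝ)| * |K x z (Sum.inl κ₁) (Sum.inl κ₂)| ≤ l1 (x - z) * (B * Real.exp (-m * l1 (x - z))) :=
        mul_le_mul (abs_cast_apply_le_l1 (x - z) i) (hK x κ₁ κ₂) (abs_nonneg _) (l1_nonneg _)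
    _ = B * (l1 (x - z) * Real.exp (-m * l1 (x - z))) := by ring
    _ ≤ B * (2 / m * Real.exp (-(m / 2) * l1 (x - z))) := mul_le_mul_of_nonneg_left hme hB
    _ = _ := by ring

include hB hK in
/-- [folklore] The column dipole moments are absolutely summable. -/
theorem summable_moment (hm0 : 0 < m) (i κ₁ κ₂ : Fin (d + 1)) :
    Summable fun x : Fin (d + 1) → ℤ => (((x - z) i : ℤ) : ℝ) * K x z (Sum.inl κ₁) (Sum.inl κ₂) :=
  Summable.of_norm_bounded ((summable_exp_shift' (half_pos hm0) z).mul_left (B * (2 / m)))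
    fun x => by rw [Real.norm_eq_abs]; exact abs_moment_term_le hB hK hm0 x i κ₁ κ₂

include hB hK in
/-- [folklore] Size of a column DIPOLE MOMENT: `|Π_i(z; κ₁κ₂)| = |Σ'_x (x−z)_i·S₀ x z κ₁κ₂| ≤ B·(2∕m)·Zl(m∕2)`. -/
theorem abs_moment_le (hm0 : 0 < m) (i κ₁ κ₂ : Fin (d + 1)) :
    |∑' x : Fin (d + 1) → ℤ, (((x - z) i : ℤ) : ℝ) * K x z (Sum.inl κ₁) (Sum.inl κ₂)| ≤ B * (2 / m) * Zl (d + 1) (m / 2) := by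
  have h := abs_tsum_le_tsum_of_abs_le (fun x => abs_moment_term_le hB hK hm0 x i κ₁ κ₂)
    ((summable_exp_shift' (half_pos hm0) z).mul_left (B * (2 / m)))
  rw [tsum_mul_left, tsum_exp_shift'] at h
  exact h

include hm hκ hB hpl hql hg hg' hK hl hl' hlam1 hlam2 in
/-- NOT IN PRINT; OUR BOOKKEEPING ([folklore] second-order lattice Taylor `LayerPushMoments.abs_sub_sub_lin_le_of_unit_steps` for the gauge function from `z`, the left leg frozen at
`z` by its Lipschitz allowance, `LayerPushMoments.sq_mul_exp_neg_le`).  **ONE COLUMN MINUS ITS DIPOLE TERM CARRIES ONE GRADIENT CONSTANT**: with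
`Π_i(z; κ₁κ₂) := Σ'_x (x−z)_i·S₀ x z κ₁κ₂` the companion's column dipole moments,
`|Σ'_x Σ_{κ₁} lx κ₁ x·S₀ x z κ₁κ₂·(λ z − λ x) + Σ_{κ₁} Σ_i lx κ₁ z·(λ(z+e_i) − λ z)·Π_i(z; κ₁κ₂)| ≤ (d+1)²·B·(ql·g + pl·g′)·(8∕(m−2κ)²)·Zl((m−2κ)∕4)`:
the constant part of `λ` is killed by the commutator (NO charge hypothesis), the linear part is the displayed dipole term (gauge table leg and left leg AT THE COLUMN
SITE), and every remaining monomial has ONE first difference more than the base count — `g′` (unit differences of the gauge table leg) against `pl`, or `ql` (unit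
gradient of the kernel leg) against `g`. -/
theorem abs_col_sub_dipole_le (hm0 : 0 < m) (κ₂ : Fin (d + 1)) :
    |(∑' x : Fin (d + 1) → ℤ, ∑ κ₁ : Fin (d + 1), lx κ₁ x * (K x z (Sum.inl κ₁) (Sum.inl κ₂) * (lam z - lam x)))
        + ∑ κ₁ : Fin (d + 1), ∑ i : Fin (d + 1),
            (lx κ₁ z * (lam (z + Pi.single i 1) - lam z)) * ∑' x : Fin (d + 1) → ℤ, (((x - z) i : ℤ) : ℝ) * K x z (Sum.inl κ₁) (Sum.inl κ₂)|
      ≤ ((d : ℝ) + 1) ^ 2 * B * (ql * g + pl * g') * (8 / (m - 2 * κ) ^ 2) * Zl (d + 1) ((m - 2 * κ) / 4) := by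
  have hc : 0 < m - 2 * κ := sub_pos.2 hm
  -- the two pointwise pieces
  obtain ⟨T, hT⟩ : ∃ T : (Fin (d + 1) → ℤ) → ℝ,
      T = fun x => ∑ κ₁ : Fin (d + 1), lx κ₁ x * (K x z (Sum.inl κ₁) (Sum.inl κ₂) * (lam z - lam x)) := ⟨_, rfl⟩
  obtain ⟨D, hD⟩ : ∃ D : (Fin (d + 1) → ℤ) → ℝ,
      D = fun x => ∑ κ₁ : Fin (d + 1), ∑ i : Fin (d + 1),
        (lx κ₁ z * (lam (z + Pi.single i 1) - lam z)) * ((((x - z) i : ℤ) : ℝ) * K x z (Sum.inl κ₁) (Sum.inl κ₂)) := ⟨_, rfl⟩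
  -- (1) `Σ' D` is the dipole sum
  have hDs : ∀ κ₁ i, Summable fun x : Fin (d + 1) → ℤ =>
      (lx κ₁ z * (lam (z + Pi.single i 1) - lam z)) * ((((x - z) i : ℤ) : ℝ) * K x z (Sum.inl κ₁) (Sum.inl κ₂)) :=
    fun κ₁ i => (summable_moment hB hK hm0 i κ₁ κ₂).mul_left _
  have hDsum : Summable D := by
    rw [hD]; exact summable_sum fun κ₁ _ => summable_sum fun i _ => hDs κ₁ i
  have hDtsum : ∑' x, D x = ∑ κ₁ : Fin (d + 1), ∑ i : Fin (d + 1),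
      (lx κ₁ z * (lam (z + Pi.single i 1) - lam z)) * ∑' x : Fin (d + 1) → ℤ, (((x - z) i : ℤ) : ℝ) * K x z (Sum.inl κ₁) (Sum.inl κ₂) := by
    rw [hD, Summable.tsum_finsetSum (fun κ₁ _ => summable_sum fun i _ => hDs κ₁ i)]
    refine Finset.sum_congr rfl fun κ₁ _ => ?_
    rw [Summable.tsum_finsetSum (fun i _ => hDs κ₁ i)]
    exact Finset.sum_congr rfl fun i _ => tsum_mul_left
  have hTsum : Summable T := by rw [hT]; exact summable_colTerm hm hκ hB hpl hg hK hl hlam1 κ₂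
  -- (2) the pointwise bound of `T + D`
  have hTD : ∀ x, |T x + D x| ≤ (((d : ℝ) + 1) ^ 2 * B * (ql * g + pl * g') * (8 / (m - 2 * κ) ^ 2)) * Real.exp (-((m - 2 * κ) / 4) * l1 (x - z)) := by
    intro x
    have ht0 : 0 ≤ l1 (x - z) := l1_nonneg _
    obtain ⟨Lin, hLin⟩ : ∃ Lin : ℝ, Lin = ∑ i : Fin (d + 1), (((x - z) i : ℤ) : ℝ) * (lam (z + Pi.single i 1) - lam z) := ⟨_, rfl⟩
    -- algebra: `T x + D x = Σ_{κ₁} K·(−(lx x − lx z)·Lin − lx x·R₂)`, `R₂ = λ x − λ z − Lin`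
    have e : T x + D x = ∑ κ₁ : Fin (d + 1), K x z (Sum.inl κ₁) (Sum.inl κ₂) * (-(lx κ₁ x - lx κ₁ z) * Lin - lx κ₁ x * (lam x - lam z - Lin)) := by
      rw [hT, hD]
      simp only []
      rw [← Finset.sum_add_distrib]
      refine Finset.sum_congr rfl fun κ₁ _ => ?_
      have e1 : ∑ i : Fin (d + 1), (lx κ₁ z * (lam (z + Pi.single i 1) - lam z)) * ((((x - z) i : ℤ) : ℝ) * K x z (Sum.inl κ₁) (Sum.inl κ₂))
          = K x z (Sum.inl κ₁) (Sum.inl κ₂) * lx κ₁ z * Lin := by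
        rw [hLin, Finset.mul_sum]
        exact Finset.sum_congr rfl fun i _ => by ring
      rw [e1]; ring
    -- sizes of the pieces
    have hdz0 : ∀ i, |lam (z + Pi.single i 1) - lam z| ≤ g := by
      intro i
      have h := hlam1 z i
      rwa [sub_self, show l1 (0 : Fin (d + 1) → ℤ) = 0 by simp [l1], mul_zero, Real.exp_zero, mul_one] at h
    have hLin_le : |Lin| ≤ ((d : ℝ) + 1) * g * l1 (x - z) := by
      rw [hLin]
      calc |∑ i : Fin (d + 1), (((x - z) i : ℤ) : ℝ) * (lam (z + Pi.single i 1) - lam z)|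
          ≤ ∑ i : Fin (d + 1), |(((x - z) i : ℤ) : ℝ) * (lam (z + Pi.single i 1) - lam z)| := Finset.abs_sum_le_sum_abs _ _
        _ ≤ ∑ _i : Fin (d + 1), l1 (x - z) * g := Finset.sum_le_sum fun i _ => by
            rw [abs_mul]; exact mul_le_mul (abs_cast_apply_le_l1 (x - z) i) (hdz0 i) (abs_nonneg _) ht0
        _ = _ := by rw [Finset.sum_const, Finset.card_univ, Fintype.card_fin, nsmul_eq_mul]; push_cast; ring
    have hR₂ : |lam x - lam z - Lin| ≤ g' * l1 (x - z) ^ 2 * Real.exp (κ * l1 (x - z)) := by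
      rw [hLin]; exact abs_sub_sub_lin_le_of_unit_steps (f := lam) (u := z) hg' hκ hlam2 x
    have hex1 : Real.exp (κ * l1 (x - z)) ≤ Real.exp (2 * κ * l1 (x - z)) := Real.exp_le_exp.2 (by nlinarith)
    have hd1 : (1 : ℝ) ≤ (d : ℝ) + 1 := by have : (0 : ℝ) ≤ d := Nat.cast_nonneg d; linarith
    have hpiece : ∀ κ₁, |K x z (Sum.inl κ₁) (Sum.inl κ₂) * (-(lx κ₁ x - lx κ₁ z) * Lin - lx κ₁ x * (lam x - lam z - Lin))|
        ≤ ((d : ℝ) + 1) * B * (ql * g + pl * g') * (l1 (x - z) ^ 2 * Real.exp (-(m - 2 * κ) * l1 (x - z))) := by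
      intro κ₁
      rw [abs_mul]
      have hK' := hK x κ₁ κ₂
      have hin : |-(lx κ₁ x - lx κ₁ z) * Lin - lx κ₁ x * (lam x - lam z - Lin)|
          ≤ (ql * l1 (x - z) * Real.exp (κ * l1 (x - z))) * (((d : ℝ) + 1) * g * l1 (x - z))
            + (pl * Real.exp (κ * l1 (x - z))) * (g' * l1 (x - z) ^ 2 * Real.exp (κ * l1 (x - z))) := by
        refine (abs_sub _ _).trans (add_le_add ?_ ?_)
        · rw [abs_mul, abs_neg]; exact mul_le_mul (hl' κ₁ x) hLin_le (abs_nonneg _) (by positivity)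
        · rw [abs_mul]; exact mul_le_mul (hl κ₁ x) hR₂ (abs_nonneg _) (by positivity)
      have eA : Real.exp (-m * l1 (x - z)) * Real.exp (κ * l1 (x - z)) ≤ Real.exp (-(m - 2 * κ) * l1 (x - z)) := by
        rw [← Real.exp_add]; exact Real.exp_le_exp.2 (by nlinarith)
      have eB : Real.exp (-m * l1 (x - z)) * (Real.exp (κ * l1 (x - z)) * Real.exp (κ * l1 (x - z))) = Real.exp (-(m - 2 * κ) * l1 (x - z)) := by
        rw [← Real.exp_add, ← Real.exp_add]; congr 1; ring
      calc |K x z (Sum.inl κ₁) (Sum.inl κ₂)| * |-(lx κ₁ x - lx κ₁ z) * Lin - lx κ₁ x * (lam x - lam z - Lin)|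
          ≤ (B * Real.exp (-m * l1 (x - z))) * ((ql * l1 (x - z) * Real.exp (κ * l1 (x - z))) * (((d : ℝ) + 1) * g * l1 (x - z))
              + (pl * Real.exp (κ * l1 (x - z))) * (g' * l1 (x - z) ^ 2 * Real.exp (κ * l1 (x - z)))) :=
            mul_le_mul hK' hin (abs_nonneg _) (by positivity)
        _ = ((d : ℝ) + 1) * B * ql * g * (l1 (x - z) ^ 2 * (Real.exp (-m * l1 (x - z)) * Real.exp (κ * l1 (x - z))))
            + B * pl * g' * (l1 (x - z) ^ 2 * (Real.exp (-m * l1 (x - z)) * (Real.exp (κ * l1 (x - z)) * Real.exp (κ * l1 (x - z))))) := by ring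
        _ ≤ ((d : ℝ) + 1) * B * ql * g * (l1 (x - z) ^ 2 * Real.exp (-(m - 2 * κ) * l1 (x - z)))
            + (((d : ℝ) + 1) * B * pl * g') * (l1 (x - z) ^ 2 * Real.exp (-(m - 2 * κ) * l1 (x - z))) := by
            rw [eB]
            refine add_le_add (mul_le_mul_of_nonneg_left (mul_le_mul_of_nonneg_left eA (by positivity)) (by positivity)) ?_
            refine mul_le_mul_of_nonneg_right ?_ (by positivity)
            calc B * pl * g' = 1 * (B * pl * g') := (one_mul _).symm
              _ ≤ ((d : ℝ) + 1) * (B * pl * g') := mul_le_mul_of_nonneg_right hd1 (by positivity)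
              _ = _ := by ring
        _ = _ := by ring
    have hsq := sq_mul_exp_neg_le hc ht0
    rw [e]
    calc |∑ κ₁ : Fin (d + 1), K x z (Sum.inl κ₁) (Sum.inl κ₂) * (-(lx κ₁ x - lx κ₁ z) * Lin - lx κ₁ x * (lam x - lam z - Lin))|
        ≤ ∑ κ₁ : Fin (d + 1), |K x z (Sum.inl κ₁) (Sum.inl κ₂) * (-(lx κ₁ x - lx κ₁ z) * Lin - lx κ₁ x * (lam x - lam z - Lin))| :=
          Finset.abs_sum_le_sum_abs _ _
      _ ≤ ∑ _κ₁ : Fin (d + 1), ((d : ℝ) + 1) * B * (ql * g + pl * g') * (l1 (x - z) ^ 2 * Real.exp (-(m - 2 * κ) * l1 (x - z))) :=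
          Finset.sum_le_sum fun κ₁ _ => hpiece κ₁
      _ ≤ ∑ _κ₁ : Fin (d + 1), ((d : ℝ) + 1) * B * (ql * g + pl * g') * (8 / (m - 2 * κ) ^ 2 * Real.exp (-((m - 2 * κ) / 4) * l1 (x - z))) :=
          Finset.sum_le_sum fun _ _ => mul_le_mul_of_nonneg_left hsq (by positivity)
      _ = _ := by rw [Finset.sum_const, Finset.card_univ, Fintype.card_fin, nsmul_eq_mul]; push_cast; ring
  -- (3) assemble
  have hc4 : 0 < (m - 2 * κ) / 4 := by positivity
  have h := abs_tsum_le_tsum_of_abs_le hTD ((summable_exp_shift' hc4 z).mul_left (((d : ℝ) + 1) ^ 2 * B * (ql * g + pl * g') * (8 / (m - 2 * κ) ^ 2)))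
  rw [tsum_mul_left, tsum_exp_shift', hTsum.tsum_add hDsum, hDtsum] at h
  have eT : (∑' x : Fin (d + 1) → ℤ, ∑ κ₁ : Fin (d + 1), lx κ₁ x * (K x z (Sum.inl κ₁) (Sum.inl κ₂) * (lam z - lam x))) = ∑' x, T x := by rw [hT]
  rw [eT]
  refine h.trans (le_of_eq ?_)
  ring

end Column

end Summit.QuantumFields.BalabanUV.Beta.GAN24.LayerPushGaugeTable

end
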